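import Literature.NumberTheory.ComplexMultiplication.QuarticCMTraceFieldNoSharedImaginary
import HarnessLib

/-!
# The reflex field `K*` of a cyclic or non-normal quartic CM field `K` has no imaginary quadratic subfield;
# hence `K*` and a biquadratic field share no purely imaginary element inside `ℂ`
# (Streng 2010 Ch. I Lemma 3.4 and the remark after it, Example 7.5; Shimura 1998 §8.4 Example (2)(A)–(C))

Topic `NumberTheory/ComplexMultiplication`; namespace `Literature.NumberTheory.ComplexMultiplication`. Theorem-only file
(no definition, no named fact, no `sorry`, no instance), sibling of `QuarticCMTraceFieldNoSharedImaginary` (whose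
lemmas are applied, not restated). Research context: cell `pub-hodgeav-hg6` (LADDER-HodgeAV PERC-SHAPE row 2, req-37
(A) Q2b, TABLE X row 25 — the «biquadratic centre» members; lead g4 T-line 2026-08-29T07:20:31Z; HONEST FRAMING:
pure field theory, nothing here proves HC, `HC_AV` or `HC_CM`).

THE PRINT. M. Streng, *Complex multiplication of abelian surfaces* (Leiden 2010), Ch. I Lemma 3.4: a quartic CM field
`K` is either (1) biquadratic (Galois group `C₂ × C₂`), (2) cyclic Galois, or (3) non-Galois with normal closure of group
`D₄`; remark after it: «In cases 2 and 3, the field `K` does not contain an imaginary quadratic subfield»; Lemma 3.4 (3)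
and Example 7.5: in case 3 the reflex field `K^r` is again a non-Galois quartic CM field (not isomorphic to `K`), in
case 2 `K^r ≅ K`. G. Shimura, *Abelian Varieties with Complex Multiplication and Modular Functions* (1998), §8.4
Example (2)(A)–(C): the same trichotomy, with «(A) … `K*` is an imaginary quadratic field, `K` is the composite of `K₀`
and `K*`» — i.e. `K` contains an imaginary quadratic number exactly in the biquadratic case. In the tree (all USED
below, none restated): `NumberFields.IsCMField.isGalois_and_not_isCyclic_iff_exists_sq_eq_neg` («biquadratic ⟺
`K ∋ √q`, `q < 0`»), `NumberFields.IsCMField.sq_ne_algebraMap_of_neg_of_isCyclic`,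
`traceField_eq_fieldRange_of_isCyclic` (`K* = x(K)` for cyclic `K`), `not_exists_sq_eq_neg_traceField` (for
non-normal `K`: `K*` contains no `√q`, `q < 0`, under the even-quartic presentation supplied by
`NumberFields.IsCMField.exists_evenQuartic_generator`).

THIS FILE assembles these into CM-type-free statements about the complex reflex field `K*_Φ = traceField Φ ⊂ ℂ`
of ANY CM type `Φ` of a quartic CM field `K` which is NOT biquadratic (the tree's dictionary:
`¬ (IsGalois ℚ K ∧ ¬ IsCyclic (K ≃ₐ[ℚ] K))`, equivalently every CM type of `K` is primitive,
`isPrimitive_iff_not_biquadratic`):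
* §1 **`sq_ne_of_mem_traceField_of_neg`** — `K*_Φ` contains no `w` with `w² = q < 0` rational («no imaginary
  quadratic number»); subfield form **`conj_eq_self_of_mem_of_finrank_eq_two`** — every quadratic subfield of `K*_Φ`
  is pointwise fixed by complex conjugation («the only quadratic subfield of `K*` is real»);
* §2 **`eq_zero_of_mem_of_mem_traceField_of_conj_eq_neg`** — for every quartic subfield `L ⊂ ℂ` containing an
  imaginary quadratic number (a biquadratic CM field, by the criterion above), `L ∩ K*_Φ` contains no non-zero purely
  imaginary element: such a `w` would have `[ℚ(w) : ℚ] ∈ {2, 4}`; degree `2` means `w² ∈ ℚ_{<0}` inside `K*_Φ`,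
  degree `4` means `ℚ(w) = L`, so the imaginary quadratic number of `L` lies in `K*_Φ` — both excluded by §1;
* §3 **`forall_eq_zero_of_biquadratic`** — the same in the shape of the member datum `hNA` of TABLE X row 25
  (`HodgeTheory/QuarticCentreTimesSimpleCMSurfaceProductSpan`, `Summits/…/SixfoldTableXRow25NonAligned`), with
  «`K` not biquadratic» supplied in the (NOSQ) form produced by the simplicity of the CM surface
  (`not_biquadratic_of_nosq`): **for `E = ℚ(μ₂)` biquadratic and `S` simple, (hNA) holds automatically.**

## References

* [Streng2010] M. Streng, *Complex multiplication of abelian surfaces*, PhD thesis (Leiden 2010), Ch. I Lemma 3.4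
  and the remark after it (pp. 20–21), Example 7.5. [cite: Streng2010, Ch. I Lemma 3.4]
* [Shimura1998] G. Shimura, *Abelian Varieties with Complex Multiplication and Modular Functions* (1998), §8.4
  Example (2)(A)–(C). [cite: Shimura1998, §8.4 Example (2)]
-/

noncomputable section

namespace Literature.NumberTheory.ComplexMultiplication

open Literature.AlgebraicGeometry.Motives (CMType)
open NumberField NumberField.ComplexEmbedding NumberField.IsCMField IntermediateField Polynomial
open Module (finrank)
open scoped ComplexConjugate

namespace QuarticCM

variable {K : Type} [Field K] [NumberField K] [IsCMField K]

/-! ### §0. «Not biquadratic» from (NOSQ) -/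

/-- **A quartic CM field without non-zero skew elements of rational square is not biquadratic** (Streng's remark
read backwards: a biquadratic `K` contains `θ ≠ 0`, `θ̄ = −θ`, `θ² = q ∈ ℚ_{<0}`). (NOSQ) is the form in which the
simplicity of a CM abelian surface enters (`mul_self_ne_algebraMap_of_isSimple_of_isCMTypeRealisation`).
[cite: Streng2010, Ch. I Lemma 3.4 (1)] [cite: Shimura1998, §8.4 Example (2)(A)] -/
theorem not_biquadratic_of_nosq (h4 : finrank ℚ K = 4)
    (hnosq : ∀ y : K, complexConj K y = -y → y ≠ 0 → ∀ r : ℚ, y * y ≠ algebraMap ℚ K r) :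
    ¬ (IsGalois ℚ K ∧ ¬ IsCyclic (K ≃ₐ[ℚ] K)) := by
  rintro ⟨hG, hnc⟩
  obtain ⟨θ, q, -, hθ0, hθc, hθq⟩ := NumberFields.IsCMField.exists_sq_eq_neg_of_not_isCyclic K h4 hnc
  exact hnosq θ hθc hθ0 q (by rw [← sq, hθq])

/-! ### §1. `K*` contains no imaginary quadratic number -/

/-- **The complex reflex field `K*_Φ` of a CM type of a cyclic or non-normal quartic CM field contains no `w` with
`w² = q < 0` rational** (no imaginary quadratic number). Cyclic case: `K* = x(K)` (`traceField_eq_fieldRange_of_isCyclic`)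
and `K ∌ √q` (`NumberFields.IsCMField.sq_ne_algebraMap_of_neg_of_isCyclic`); non-normal case: `K*` is Shimura's
non-normal quartic CM field `ℚ(ξ + ξ^φ)`, which is primitive (`not_exists_sq_eq_neg_traceField`).
[cite: Streng2010, Ch. I Lemma 3.4 and Example 7.5] [cite: Shimura1998, §8.4 Example (2)(B),(C)] -/
theorem sq_ne_of_mem_traceField_of_neg (h4 : finrank ℚ K = 4) (hK : ¬ (IsGalois ℚ K ∧ ¬ IsCyclic (K ≃ₐ[ℚ] K)))
    (Φ : CMType K) {w : ℂ} (hw : w ∈ traceField Φ) {q : ℚ} (hq : q < 0) : w ^ 2 ≠ (q : ℂ) := by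
  classical
  intro hwq
  by_cases hG : IsGalois ℚ K
  · -- cyclic case: `K* = x(K)`
    have hc : IsCyclic (K ≃ₐ[ℚ] K) := by
      by_contra hnc
      exact hK ⟨hG, hnc⟩
    obtain ⟨x⟩ : Nonempty (K →+* ℂ) := inferInstance
    rw [traceField_eq_fieldRange_of_isCyclic h4 hc Φ x] at hw
    obtain ⟨a, ha⟩ := AlgHom.mem_fieldRange.1 hw
    have ha' : x a = w := ha
    refine NumberFields.IsCMField.sq_ne_algebraMap_of_neg_of_isCyclic K h4 hc hq a (x.injective ?_)
    rw [map_pow, ha', hwq, eq_ratCast, map_ratCast]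
  · -- non-normal case: `K* = ℚ(φ₀ θ + φ₁ θ)` is primitive
    obtain ⟨θ, A, B, hA, hB, hD, hθtop, hθc, hf⟩ := NumberFields.IsCMField.exists_evenQuartic_generator K h4
    have hθ0 : θ ≠ 0 := by
      rintro rfl
      have h : algebraMap ℚ K B = 0 := by simpa using hf
      rw [map_eq_zero_iff _ (algebraMap ℚ K).injective] at h
      exact (lt_irrefl (0 : ℚ)) (h ▸ hB)
    obtain ⟨x⟩ : Nonempty (K →+* ℂ) := inferInstance
    obtain ⟨x₀, hx₀⟩ : ∃ x₀ : K →+* ℂ, x₀ ∈ Φ.1 := by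
      rcases CMTypeOps.mem_or_conjugate_mem Φ x with h | h
      exacts [⟨_, h⟩, ⟨_, h⟩]
    obtain ⟨y, hyx, -, hΦ⟩ := exists_eq_pair_of_finrank_eq_four h4 Φ hx₀
    have hy : y ∈ Φ.1 := by
      rw [hΦ]
      exact Or.inr rfl
    have hφ₀ : (x₀.toRatAlgHom : K →+* ℂ) ∈ Φ.1 := by rwa [RingHom.toRatAlgHom_toRingHom]
    have hφ₁ : (y.toRatAlgHom : K →+* ℂ) ∈ Φ.1 := by rwa [RingHom.toRatAlgHom_toRingHom]
    have hne : x₀.toRatAlgHom ≠ y.toRatAlgHom := fun h => hyx (by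
      rw [← RingHom.toRatAlgHom_toRingHom x₀, ← RingHom.toRatAlgHom_toRingHom y, h])
    have h := not_exists_sq_eq_neg_traceField h4 hG hθc hθ0 hf Φ hφ₀ hφ₁ hne hA hB hD hθtop
    refine h ⟨⟨w, hw⟩, q, hq, Subtype.ext ?_⟩
    have e : (((algebraMap ℚ (traceField Φ)) q : traceField Φ) : ℂ) = algebraMap ℚ ℂ q := rfl
    rw [SubmonoidClass.coe_pow, e, eq_ratCast]
    exact hwq

/-- **Every quadratic subfield of `K*_Φ` is pointwise fixed by complex conjugation** — «`K*` has no imaginary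
quadratic subfield; its only quadratic subfield is (`K*`)⁺» (for `K` cyclic or non-normal quartic CM). A quadratic
`M = ℚ(ϑ)`, `ϑ² = c ∈ ℚ`, inside `K*_Φ` has `c > 0` by §1, so `ϑ` and all of `M` are real.
[cite: Streng2010, Ch. I Lemma 3.4 and Example 7.5] [cite: Shimura1998, §8.4 Example (2)(B),(C)] -/
theorem conj_eq_self_of_mem_of_finrank_eq_two (h4 : finrank ℚ K = 4)
    (hK : ¬ (IsGalois ℚ K ∧ ¬ IsCyclic (K ≃ₐ[ℚ] K))) (Φ : CMType K) {M : IntermediateField ℚ ℂ}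
    (hM : M ≤ traceField Φ) (hM2 : finrank ℚ M = 2) {w : ℂ} (hw : w ∈ M) : conj w = w := by
  classical
  obtain ⟨ϑ, c, hϑQ, hϑc⟩ := QuadraticFields.Quadratic.exists_sq_eq_algebraMap (F := ℚ) (K := M) hM2
  -- `ϑ² = c` read in `ℂ`
  have hϑc' : ((ϑ : ℂ)) ^ 2 = (c : ℂ) := by
    have h := congrArg (fun y : M => (y : ℂ)) hϑc
    simpa [IntermediateField.algebraMap_apply] using h
  have hϑ0 : (ϑ : ℂ) ≠ 0 := fun h => hϑQ ⟨0, by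
    rw [map_zero]
    exact (Subtype.ext (by simpa using h.symm))⟩
  -- `c` is not negative (§1), not zero, hence positive, and `ϑ` is real
  have hc : 0 < c := by
    rcases lt_trichotomy c 0 with hlt | heq | hgt
    · exact absurd hϑc' (sq_ne_of_mem_traceField_of_neg h4 hK Φ (hM ϑ.2) hlt)
    · exfalso
      rw [heq, Rat.cast_zero] at hϑc'
      exact hϑ0 (pow_eq_zero_iff two_ne_zero |>.1 hϑc')
    · exact hgt
  have hϑreal : conj (ϑ : ℂ) = ϑ := by
    -- `ϑ = a + b i` with `ϑ² = c > 0` real: `ab = 0` and `a² − b² = c > 0` force `b = 0`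
    have hre : ((ϑ : ℂ) ^ 2).re = (c : ℝ) := by rw [hϑc']; norm_cast
    have him : ((ϑ : ℂ) ^ 2).im = 0 := by rw [hϑc']; norm_cast
    rw [sq, Complex.mul_re] at hre
    rw [sq, Complex.mul_im] at him
    have hb : (ϑ : ℂ).im = 0 := by
      by_contra hb
      have ha : (ϑ : ℂ).re = 0 := by
        have h2 : 2 * ((ϑ : ℂ).re * (ϑ : ℂ).im) = 0 := by linear_combination him
        rcases mul_eq_zero.1 ((mul_eq_zero.1 h2).resolve_left two_ne_zero) with h | h
        · exact h
        · exact absurd h hb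
      rw [ha, zero_mul, zero_sub] at hre
      have hcR : (0 : ℝ) < c := by exact_mod_cast hc
      nlinarith [sq_nonneg (ϑ : ℂ).im]
    exact Complex.conj_eq_iff_im.2 hb
  -- `M = ℚ(ϑ)` and every element `a + b ϑ` is real
  obtain ⟨a, b, hab⟩ := QuadraticFields.Quadratic.exists_eq_add_mul hM2 hϑQ (⟨w, hw⟩ : M)
  have hw' : w = (a : ℂ) + (b : ℂ) * ϑ := by
    have h := congrArg (fun y : M => (y : ℂ)) hab
    simpa [IntermediateField.algebraMap_apply] using h
  rw [hw', map_add, map_mul, map_ratCast, map_ratCast, hϑreal]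

/-! ### §2. `K*` and a biquadratic field share no purely imaginary element -/

/-- A purely imaginary algebraic number of degree `2` over `ℚ` has negative rational square: `w̄ = −w` is the other
root of the minimal polynomial `X² + bX + c`, so `b = 0` and `w² = −c = −|w|² < 0`. [folklore] -/
private theorem exists_sq_eq_neg_of_conj_eq_neg_of_natDegree_eq_two {w : ℂ} (hint : IsIntegral ℚ w)
    (hconj : conj w = -w) (hw0 : w ≠ 0) (hd : (minpoly ℚ w).natDegree = 2) :
    ∃ q : ℚ, q < 0 ∧ w ^ 2 = (q : ℂ) := by
  classical
  have hmonic : (minpoly ℚ w).Monic := minpoly.monic hint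
  set b : ℚ := (minpoly ℚ w).coeff 1 with hb
  set c : ℚ := (minpoly ℚ w).coeff 0 with hc
  have hp : minpoly ℚ w = X ^ 2 + (C c + C b * X) := by
    rw [hmonic.as_sum, hd, Finset.sum_range_succ, Finset.sum_range_one, pow_zero, mul_one, pow_one]
  have h0 : w ^ 2 + (b : ℂ) * w + (c : ℂ) = 0 := by
    have h := minpoly.aeval ℚ w
    rw [hp] at h
    simp only [map_add, map_mul, map_pow, aeval_X, aeval_C, eq_ratCast] at h
    linear_combination h
  have h0' : w ^ 2 - (b : ℂ) * w + (c : ℂ) = 0 := by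
    have h := congrArg conj h0
    rw [map_add, map_add, map_mul, map_pow, hconj, map_ratCast, map_ratCast, map_zero] at h
    linear_combination h
  have hbw : (2 : ℂ) * ((b : ℂ) * w) = 0 := by linear_combination h0 - h0'
  have hb0 : (b : ℂ) = 0 := by
    rcases mul_eq_zero.1 ((mul_eq_zero.1 hbw).resolve_left two_ne_zero) with h | h
    · exact h
    · exact absurd h hw0
  have hwc : w ^ 2 = ((-c : ℚ) : ℂ) := by
    rw [Rat.cast_neg]
    rw [hb0, zero_mul, add_zero] at h0
    linear_combination h0
  refine ⟨-c, ?_, hwc⟩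
  -- `w² = −|w|² < 0`
  have him : w.re = 0 := by
    have h := congrArg Complex.re hconj
    rw [Complex.conj_re, Complex.neg_re] at h
    linarith
  have hne : w.im ≠ 0 := fun h => hw0 (Complex.ext (by rw [him, Complex.zero_re]) (by rw [h, Complex.zero_im]))
  have hre : (w ^ 2).re = ((-c : ℚ) : ℝ) := by
    rw [hwc]
    norm_cast
  rw [sq, Complex.mul_re, him, zero_mul, zero_sub] at hre
  have h2 : (((-c : ℚ) : ℝ)) < 0 := by
    rw [← hre, neg_lt_zero]
    exact mul_self_pos.2 hne
  exact_mod_cast h2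

/-- **`K*_Φ` and a biquadratic field `L ⊂ ℂ` share no non-zero purely imaginary element** (`K` a cyclic or non-normal
quartic CM field, `Φ` any CM type; `L` any quartic subfield of `ℂ` containing an imaginary quadratic number — for a
quartic CM field this is «`L` biquadratic», `NumberFields.IsCMField.isGalois_and_not_isCyclic_iff_exists_sq_eq_neg`):
a purely imaginary `w ≠ 0` in `L ∩ K*_Φ` has `[ℚ(w) : ℚ] ∈ {1, 2, 4}`; `1` makes `w` real, `2` puts `√(w²)`,
`w² ∈ ℚ_{<0}`, in `K*_Φ`, `4` gives `ℚ(w) = L ≤ K*_Φ` and puts the imaginary quadratic number of `L` in `K*_Φ` — the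
last two excluded by §1 (Streng: `K^r`, like `K`, «does not contain an imaginary quadratic subfield»).
[cite: Streng2010, Ch. I Lemma 3.4 and Example 7.5] [cite: Shimura1998, §8.4 Example (2)(A)–(C)] -/
theorem eq_zero_of_mem_of_mem_traceField_of_conj_eq_neg (h4 : finrank ℚ K = 4)
    (hK : ¬ (IsGalois ℚ K ∧ ¬ IsCyclic (K ≃ₐ[ℚ] K))) (Φ : CMType K) {L : IntermediateField ℚ ℂ}
    (hL4 : finrank ℚ L = 4) (hL : ∃ ϑ ∈ L, ∃ q : ℚ, q < 0 ∧ ϑ ^ 2 = (q : ℂ)) {w : ℂ} (hwL : w ∈ L)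
    (hwt : w ∈ traceField Φ) (hconj : conj w = -w) : w = 0 := by
  classical
  by_contra hw0
  haveI : FiniteDimensional ℚ L := Module.finite_of_finrank_eq_succ hL4
  set w' : L := ⟨w, hwL⟩ with hw'
  have hint' : IsIntegral ℚ w' := Algebra.IsIntegral.isIntegral w'
  have hmin : minpoly ℚ w = minpoly ℚ w' := by
    have h := minpoly.algHom_eq L.val Subtype.val_injective w'
    exact h
  have hint : IsIntegral ℚ w := by
    have h := hint'.map L.val
    exact h
  -- `[ℚ(w) : ℚ]` divides `4`
  have hdvd : (minpoly ℚ w).natDegree ∣ 4 := by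
    have h := Module.finrank_mul_finrank ℚ ℚ⟮w'⟯ L
    rw [adjoin.finrank hint', hL4, ← hmin] at h
    exact Dvd.intro _ h
  have hdvd' : (minpoly ℚ w).natDegree ∣ 2 ^ 2 := by norm_num; exact hdvd
  obtain ⟨k, hk, hkd⟩ := (Nat.dvd_prime_pow Nat.prime_two).1 hdvd'
  interval_cases k
  · -- degree `1`: `w ∈ ℚ` is real
    rw [pow_zero] at hkd
    obtain ⟨r, hr⟩ := minpoly.natDegree_eq_one_iff.1 hkd
    apply hw0
    have hreal : conj w = w := by rw [← hr, eq_ratCast, map_ratCast]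
    have h2 : (2 : ℂ) * w = 0 := by linear_combination hreal.symm.trans hconj
    exact (mul_eq_zero.1 h2).resolve_left two_ne_zero
  · -- degree `2`: `w² ∈ ℚ_{<0}` inside `K*`
    rw [pow_one] at hkd
    obtain ⟨q, hq, hwq⟩ := exists_sq_eq_neg_of_conj_eq_neg_of_natDegree_eq_two hint hconj hw0 hkd
    exact sq_ne_of_mem_traceField_of_neg h4 hK Φ hwt hq hwq
  · -- degree `4`: `ℚ(w) = L`, so the imaginary quadratic number of `L` lies in `K*`
    have hkd4 : (minpoly ℚ w).natDegree = 4 := by simpa using hkd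
    have hLw : ℚ⟮w⟯ = L :=
      IntermediateField.eq_of_le_of_finrank_eq (adjoin_simple_le_iff.2 hwL) (by rw [adjoin.finrank hint, hkd4, hL4])
    obtain ⟨ϑ, hϑL, q, hq, hϑq⟩ := hL
    have hϑt : ϑ ∈ traceField Φ := by
      rw [← hLw] at hϑL
      exact adjoin_simple_le_iff.2 hwt hϑL
    exact sq_ne_of_mem_traceField_of_neg h4 hK Φ hϑt hq hϑq

/-! ### §3. The consumer shape: TABLE X row 25's datum (hNA) for a biquadratic centre -/

/-- **«Biquadratic centre ⟹ non-aligned»**, in the shape of the member datum `hNA` of TABLE X row 25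
(`HodgeTheory/QuarticCentreTimesSimpleCMSurfaceProductSpan`): if the quartic field `ℚ(μ₂) ⊂ ℂ` contains an imaginary
quadratic number (is biquadratic) and the quartic CM field `K` has no non-zero skew element of rational square
((NOSQ) — automatic for the CM field of a SIMPLE CM abelian surface), then every purely imaginary element of
`ℚ(μ₂) ∩ K*_Φ` vanishes, for every CM type `Φ` of `K`. [cite: Streng2010, Ch. I Lemma 3.4 and Example 7.5]
[cite: Shimura1998, §8.4 Example (2)(A)–(C)] -/
theorem forall_eq_zero_of_biquadratic (h4 : finrank ℚ K = 4)
    (hnosq : ∀ y : K, complexConj K y = -y → y ≠ 0 → ∀ r : ℚ, y * y ≠ algebraMap ℚ K r)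
    (Φ : CMType K) {μ₂ : ℂ} (h4μ : finrank ℚ ℚ⟮μ₂⟯ = 4) (hbq : ∃ ϑ ∈ ℚ⟮μ₂⟯, ∃ q : ℚ, q < 0 ∧ ϑ ^ 2 = (q : ℂ)) :
    ∀ w : ℂ, w ∈ ℚ⟮μ₂⟯ → w ∈ traceField Φ → conj w = -w → w = 0 :=
  fun _ hw hwt hconj =>
    eq_zero_of_mem_of_mem_traceField_of_conj_eq_neg h4 (not_biquadratic_of_nosq h4 hnosq) Φ h4μ hbq hw hwt hconj

end QuarticCM

end Literature.NumberTheory.ComplexMultiplication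

end
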